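import Summits.MatrixMultiplication.MatrixMultiplication.Theorems.ObstructionCalculusInvariants

/-!
# ObstructionDescent — the obstruction calculus, PART 3 of 5: `ObstructionCalculusSlots`

LANDING SPLIT (decomp-mm-lander-1 g1, 2026-08-30; mechanical, for the 400-line lint; REQUESTS #16-ii, decomp-mm SUMMON
Tier 3 (10)) of «Part 1 + Part 1b — the obstruction calculus on cubic tensor formats» of the lens-3 gen-8 kernel
`DegreeFiltration_g8_tree.lean` (sha256 `132d565c…aec8`, 2383 lines; critic-CLEARED decomp-mm STATUS l.348/365; rc0, the
calculus parts sorry-free).  This file = §A «BorelToolkit» (Borel normal form `exists_borel_mulVec_eq_zero`) and §B «Slots» (slot calculus) (source lines 606–868),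
copied byte-identically inside the source namespace `Summit.MatrixMultiplication.MatrixMultiplication.Theorems.ObstructionCalculus`
with the source header (`noncomputable section`, opens); the nine `@[simp]` rfl-lemmas `slot_*`/`slotMat_*`/`slotAct_*` got one-line
docstrings (gate lint.docstring), nothing else changed.  Route-free: imports Literature / the previous part only, NO `Theses`
file (lint `theses-cone`).  The five parts Action → Invariants → Slots → PadInheritance → Locality form one import chain and
SUPPORT the crux `NoOccurrenceObstruction` (item `stmt-MatrixMultiplication-29040`, route-MatrixMultiplication-ObstructionDescent)
WITHOUT closing anything; nothing here proves ω = 2.  Full mathematical commentary: the module docstring of the source kernel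
(HOME/decomp-mm-lens-3/pkg-ObstructionDescent-g8/) and the docstrings below.
-/

set_option linter.dupNamespace false
set_option autoImplicit false

noncomputable section

open scoped BigOperators
open Filter Asymptotics Finset

namespace Summit.MatrixMultiplication.MatrixMultiplication.Theorems.ObstructionCalculus

open Literature.Computability.AlgebraicComplexity (triad triad_apply tensorRank matMulTensor unitTensor
  exists_eq_sum_triad_of_tensorRank_le actTensor actTensor_apply actTensor_actTensor
  tensorRank_le_card_of_eq_sum)

section BorelToolkit

variable {m : ℕ}

/-- `1 ∈ B_m`. [bookkeeping] -/
theorem one_mem_borel : (1 : Matrix (Fin m) (Fin m) ℂ) ∈ borel m :=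
  ⟨fun _ _ hij => Matrix.one_apply_ne (ne_of_lt hij).symm, fun i => by
    rw [Matrix.one_apply_eq]; exact one_ne_zero⟩

/-- Invertible diagonal matrices lie in `B_m`. [bookkeeping] -/
theorem diagonal_mem_borel {δ : Fin m → ℂ} (hδ : ∀ i, δ i ≠ 0) : Matrix.diagonal δ ∈ borel m :=
  ⟨fun _ _ hij => Matrix.diagonal_apply_ne δ (ne_of_lt hij).symm, fun i => by
    rw [Matrix.diagonal_apply_eq]; exact hδ i⟩

/-- `B_m` is closed under multiplication. [bookkeeping] -/
theorem mul_mem_borel {b c : Matrix (Fin m) (Fin m) ℂ} (hb : b ∈ borel m) (hc : c ∈ borel m) :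
    b * c ∈ borel m := by
  refine ⟨fun i j hij => ?_, fun i => ?_⟩
  · rw [Matrix.mul_apply]
    refine Finset.sum_eq_zero fun l _ => ?_
    by_cases hl : l < i
    · rw [hb.1 i l hl, zero_mul]
    · rw [hc.1 l j (lt_of_lt_of_le hij (not_lt.1 hl)), mul_zero]
  · rw [Matrix.mul_apply, Finset.sum_eq_single i]
    · exact mul_ne_zero (hb.2 i) (hc.2 i)
    · intro l _ hl
      rcases lt_or_gt_of_ne hl with h | h
      · rw [hb.1 i l h, zero_mul]
      · rw [hc.1 l i h, mul_zero]
    · exact fun h => (h (Finset.mem_univ i)).elim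

/-- The character of `1` is `1`. [bookkeeping] -/
theorem weightChar_one (lam : Fin m → ℕ) : weightChar lam (1 : Matrix (Fin m) (Fin m) ℂ) = 1 := by
  unfold weightChar
  exact Finset.prod_eq_one fun i _ => by rw [Matrix.one_apply_eq, one_pow]

/-- Characters do not vanish on `B_m`. [bookkeeping] -/
theorem weightChar_ne_zero (lam : Fin m → ℕ) {b : Matrix (Fin m) (Fin m) ℂ} (hb : b ∈ borel m) :
    weightChar lam b ≠ 0 :=
  Finset.prod_ne_zero_iff.2 fun i _ => pow_ne_zero _ (hb.2 i)

/-- The character of a diagonal matrix. [bookkeeping] -/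
theorem weightChar_diagonal (lam : Fin m → ℕ) (δ : Fin m → ℂ) :
    weightChar lam (Matrix.diagonal δ) = ∏ i, δ i ^ lam i := by
  unfold weightChar
  exact Finset.prod_congr rfl fun i _ => by rw [Matrix.diagonal_apply_eq]

/-- **Borel normal form of a finite family of vectors.** For any `k` vectors `v₀,…,v_{k-1} ∈ ℂ^m` there is
an upper-triangular invertible `b ∈ B_m` and a set `S` of at most `k` coordinates such that every `b·vᵢ`
is supported in `S` (row-echelon reduction by upward row operations only; the `B`-orbit representative of
the span in its Schubert cell). [folklore] -/
theorem exists_borel_mulVec_eq_zero (k : ℕ) : ∀ v : Fin k → Fin m → ℂ,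
    ∃ b ∈ borel m, ∃ S : Finset (Fin m), S.card ≤ k ∧ ∀ i a, a ∉ S → (b.mulVec (v i)) a = 0 := by
  classical
  induction k with
  | zero => exact fun _ => ⟨1, one_mem_borel, ∅, le_rfl, fun i => Fin.elim0 i⟩
  | succ k ih =>
    intro v
    obtain ⟨b, hb, S, hSk, hS⟩ := ih fun i => v (Fin.castSucc i)
    obtain ⟨w, hw⟩ : ∃ w : Fin m → ℂ, w = b.mulVec (v (Fin.last k)) := ⟨_, rfl⟩
    by_cases hcase : ∀ a, a ∉ S → w a = 0
    · refine ⟨b, hb, S, hSk.trans (Nat.le_succ k), fun i a ha => ?_⟩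
      cases i using Fin.lastCases with
      | last => rw [← hw]; exact hcase a ha
      | cast j => exact hS j a ha
    · push Not at hcase
      -- the pivot: the largest coordinate outside `S` where `w` does not vanish
      obtain ⟨p, hpS, hwp, hmax⟩ : ∃ p, p ∉ S ∧ w p ≠ 0 ∧ ∀ a, a ∉ S → w a ≠ 0 → a ≤ p := by
        let F : Finset (Fin m) := Finset.univ.filter fun a => a ∉ S ∧ w a ≠ 0
        have hFne : F.Nonempty := by
          obtain ⟨a, haS, hwa⟩ := hcase
          exact ⟨a, Finset.mem_filter.2 ⟨Finset.mem_univ a, haS, hwa⟩⟩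
        have hpF := F.max'_mem hFne
        exact ⟨F.max' hFne, (Finset.mem_filter.1 hpF).2.1, (Finset.mem_filter.1 hpF).2.2,
          fun a haS hwa => F.le_max' a (Finset.mem_filter.2 ⟨Finset.mem_univ a, haS, hwa⟩)⟩
      -- the eliminating matrix `c = 1 + E`, `E` supported in column `p` strictly above the diagonal
      obtain ⟨E, hE⟩ : ∃ E : Matrix (Fin m) (Fin m) ℂ,
          E = fun a j => if j = p ∧ a < p ∧ a ∉ S then -(w a) / w p else 0 := ⟨_, rfl⟩
      have hEmul : ∀ x : Fin m → ℂ, ∀ a,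
          (E.mulVec x) a = (if a < p ∧ a ∉ S then -(w a) / w p else 0) * x p := by
        intro x a
        change ∑ j, E a j * x j = _
        rw [Finset.sum_eq_single p]
        · rw [hE]
          simp only [true_and]
        · intro j _ hj
          rw [hE]
          simp only [hj, false_and, if_false, zero_mul]
        · exact fun h => (h (Finset.mem_univ p)).elim
      have hcmul : ∀ x : Fin m → ℂ, ∀ a,
          ((1 + E).mulVec x) a = x a + (if a < p ∧ a ∉ S then -(w a) / w p else 0) * x p := by
        intro x a
        rw [Matrix.add_mulVec, Matrix.one_mulVec, Pi.add_apply, hEmul]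
      have hcB : (1 + E) ∈ borel m := by
        refine ⟨fun i j hij => ?_, fun i => ?_⟩
        · have h1 : (1 : Matrix (Fin m) (Fin m) ℂ) i j = 0 := Matrix.one_apply_ne (ne_of_lt hij).symm
          have h2 : E i j = 0 := by
            rw [hE]
            exact if_neg fun h : j = p ∧ i < p ∧ i ∉ S => lt_asymm hij (h.1 ▸ h.2.1)
          rw [Matrix.add_apply, h1, h2, add_zero]
        · have h2 : E i i = 0 := by
            rw [hE]
            exact if_neg fun h : i = p ∧ i < p ∧ i ∉ S => lt_irrefl _ (h.1 ▸ h.2.1 : i < i)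
          rw [Matrix.add_apply, h2, add_zero, Matrix.one_apply_eq]
          exact one_ne_zero
      refine ⟨(1 + E) * b, mul_mem_borel hcB hb, insert p S,
        (Finset.card_insert_le p S).trans (Nat.succ_le_succ hSk), fun i a ha => ?_⟩
      rw [Finset.mem_insert, not_or] at ha
      obtain ⟨hap, haS⟩ := ha
      rw [← Matrix.mulVec_mulVec, hcmul]
      cases i using Fin.lastCases with
      | cast j => rw [hS j a haS, hS j p hpS, mul_zero, add_zero]
      | last =>
        rw [← hw]
        by_cases hlt : a < p
        · rw [if_pos ⟨hlt, haS⟩, div_mul_cancel₀ _ hwp, add_neg_cancel]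
        · rw [if_neg fun h => hlt h.1, zero_mul, add_zero]
          by_contra hwa
          exact hlt (lt_of_le_of_ne (hmax a haS hwa) hap)

end BorelToolkit

section Slots

variable {m : ℕ}

/-- Case analysis on the three slots. [bookkeeping] -/
theorem forall_fin_three {P : Fin 3 → Prop} : (∀ s, P s) ↔ P 0 ∧ P 1 ∧ P 2 :=
  ⟨fun h => ⟨h 0, h 1, h 2⟩, fun h s => by fin_cases s; exacts [h.1, h.2.1, h.2.2]⟩

/-- The `s`-th coordinate of an index triple. [bookkeeping] -/
def slot (s : Fin 3) (p : Idx m) : Fin m := ![p.1, p.2.1, p.2.2] s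

/-- Slot `0` of a coordinate triple is its first component. (`rfl`; docstring added at landing, lint.docstring) [bookkeeping] -/
@[simp] theorem slot_zero (p : Idx m) : slot 0 p = p.1 := rfl
/-- Slot `1` of a coordinate triple is its second component. (`rfl`; docstring added at landing, lint.docstring) [bookkeeping] -/
@[simp] theorem slot_one (p : Idx m) : slot 1 p = p.2.1 := rfl
/-- Slot `2` of a coordinate triple is its third component. (`rfl`; docstring added at landing, lint.docstring) [bookkeeping] -/
@[simp] theorem slot_two (p : Idx m) : slot 2 p = p.2.2 := rfl

/-- The `s`-th matrix of a triple. [bookkeeping] -/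
def slotMat (s : Fin 3) (A B C : Matrix (Fin m) (Fin m) ℂ) : Matrix (Fin m) (Fin m) ℂ := ![A, B, C] s

/-- `slotMat 0 A B C = A`. (`rfl`; docstring added at landing, lint.docstring) [bookkeeping] -/
@[simp] theorem slotMat_zero (A B C : Matrix (Fin m) (Fin m) ℂ) : slotMat 0 A B C = A := rfl
/-- `slotMat 1 A B C = B`. (`rfl`; docstring added at landing, lint.docstring) [bookkeeping] -/
@[simp] theorem slotMat_one (A B C : Matrix (Fin m) (Fin m) ℂ) : slotMat 1 A B C = B := rfl
/-- `slotMat 2 A B C = C`. (`rfl`; docstring added at landing, lint.docstring) [bookkeeping] -/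
@[simp] theorem slotMat_two (A B C : Matrix (Fin m) (Fin m) ℂ) : slotMat 2 A B C = C := rfl

/-- The action of ONE matrix `X` in slot `s` (identity in the other two slots). [bookkeeping] -/
def slotAct (s : Fin 3) (X : Matrix (Fin m) (Fin m) ℂ) (t : Tensor ℂ m) : Tensor ℂ m :=
  ![actTensor X 1 1 t, actTensor 1 X 1 t, actTensor 1 1 X t] s

/-- The one-slot action in slot `0` acts by `X` on the first tensor leg (and by `1` on the others). (`rfl`; docstring added at landing, lint.docstring) [bookkeeping] -/
@[simp] theorem slotAct_zero (X : Matrix (Fin m) (Fin m) ℂ) (t : Tensor ℂ m) :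
    slotAct 0 X t = actTensor X 1 1 t := rfl
/-- The one-slot action in slot `1` acts by `X` on the second tensor leg (and by `1` on the others). (`rfl`; docstring added at landing, lint.docstring) [bookkeeping] -/
@[simp] theorem slotAct_one (X : Matrix (Fin m) (Fin m) ℂ) (t : Tensor ℂ m) :
    slotAct 1 X t = actTensor 1 X 1 t := rfl
/-- The one-slot action in slot `2` acts by `X` on the third tensor leg (and by `1` on the others). (`rfl`; docstring added at landing, lint.docstring) [bookkeeping] -/
@[simp] theorem slotAct_two (X : Matrix (Fin m) (Fin m) ℂ) (t : Tensor ℂ m) :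
    slotAct 2 X t = actTensor 1 1 X t := rfl

/-- Weight vectors transform under a one-slot Borel action by the slot's character. [bookkeeping] -/
theorem evalT_slotAct {Λ : Fin 3 → Fin m → ℕ} {d : ℕ} {f : MvPolynomial (Idx m) ℂ}
    (hf : f ∈ hwvSpace Λ d) {X : Matrix (Fin m) (Fin m) ℂ} (hX : X ∈ borel m) (t : Tensor ℂ m) :
    ∀ s : Fin 3, evalT (slotAct s X t) f = weightChar (Λ s) X * evalT t f := by
  refine forall_fin_three.2 ⟨?_, ?_, ?_⟩
  · have h := hf.2 X 1 1 hX one_mem_borel one_mem_borel t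
    rw [weightChar_one, weightChar_one, mul_one, mul_one] at h
    rw [slotAct_zero]
    exact h
  · have h := hf.2 1 X 1 one_mem_borel hX one_mem_borel t
    rw [weightChar_one, weightChar_one, one_mul, mul_one] at h
    rw [slotAct_one]
    exact h
  · have h := hf.2 1 1 X one_mem_borel one_mem_borel hX t
    rw [weightChar_one, weightChar_one, one_mul, one_mul] at h
    rw [slotAct_two]
    exact h

/-- A one-slot action composed with a triple action is a triple action whose slot-`s` matrix is
multiplied on the left. [folklore] -/
theorem exists_slotAct_actTensor_eq (X A B C : Matrix (Fin m) (Fin m) ℂ) (t : Tensor ℂ m) :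
    ∀ s : Fin 3, ∃ A' B' C' : Matrix (Fin m) (Fin m) ℂ,
      slotAct s X (actTensor A B C t) = actTensor A' B' C' t ∧
        slotMat s A' B' C' = X * slotMat s A B C := by
  refine forall_fin_three.2 ⟨⟨X * A, B, C, ?_, rfl⟩, ⟨A, X * B, C, ?_, rfl⟩, ⟨A, B, X * C, ?_, rfl⟩⟩
  · rw [slotAct_zero, actTensor_actTensor, Matrix.one_mul, Matrix.one_mul]
  · rw [slotAct_one, actTensor_actTensor, Matrix.one_mul, Matrix.one_mul]
  · rw [slotAct_two, actTensor_actTensor, Matrix.one_mul, Matrix.one_mul]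

/-- The action of three diagonal matrices rescales entries. [folklore] -/
theorem actTensor_diagonal (x y z : Fin m → ℂ) (t : Tensor ℂ m) :
    actTensor (Matrix.diagonal x) (Matrix.diagonal y) (Matrix.diagonal z) t =
      fun a b c => x a * y b * z c * t a b c := by
  funext a b c
  rw [actTensor_apply, Finset.sum_eq_single a, Finset.sum_eq_single b, Finset.sum_eq_single c]
  · simp only [Matrix.diagonal_apply_eq]
  all_goals first
    | exact fun h => (h (Finset.mem_univ _)).elim
    | (intro k _ hk; simp [Matrix.diagonal_apply_ne _ (Ne.symm hk)])

/-- A diagonal one-slot action rescales entries by the slot coordinate. [folklore] -/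
theorem slotAct_diagonal (δ : Fin m → ℂ) (t : Tensor ℂ m) :
    ∀ s : Fin 3, slotAct s (Matrix.diagonal δ) t = fun a b c => δ (slot s (a, b, c)) * t a b c := by
  have h1 : (1 : Matrix (Fin m) (Fin m) ℂ) = Matrix.diagonal fun _ => 1 := Matrix.diagonal_one.symm
  refine forall_fin_three.2 ⟨?_, ?_, ?_⟩
  · rw [slotAct_zero, h1, actTensor_diagonal]
    funext a b c
    simp
  · rw [slotAct_one, h1, actTensor_diagonal]
    funext a b c
    simp
  · rw [slotAct_two, h1, actTensor_diagonal]
    funext a b c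
    simp

/-- Transport of slot supports: if `t` is supported (in slot `s`) in `T` and the slot-`s` matrix kills
`T` outside `S`, then `(A,B,C)·t` is supported in `S`. [folklore] -/
theorem slot_mem_of_actTensor_ne_zero {S T : Finset (Fin m)} {A B C : Matrix (Fin m) (Fin m) ℂ}
    {t : Tensor ℂ m} : ∀ s : Fin 3, (∀ a b c, t a b c ≠ 0 → slot s (a, b, c) ∈ T) →
      (∀ a, a ∉ S → ∀ i ∈ T, slotMat s A B C a i = 0) →
        ∀ a b c, actTensor A B C t a b c ≠ 0 → slot s (a, b, c) ∈ S := by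
  refine forall_fin_three.2 ⟨?_, ?_, ?_⟩
  · intro hT hG a b c hne
    by_contra haS
    apply hne
    rw [actTensor_apply]
    refine Finset.sum_eq_zero fun i _ => Finset.sum_eq_zero fun j _ =>
      Finset.sum_eq_zero fun k _ => ?_
    by_cases hi : i ∈ T
    · rw [show A a i = 0 from hG a haS i hi, zero_mul, zero_mul, zero_mul]
    · rw [show t i j k = 0 from not_not.1 fun h => hi (hT i j k h), mul_zero]
  · intro hT hG a b c hne
    by_contra hbS
    apply hne
    rw [actTensor_apply]
    refine Finset.sum_eq_zero fun i _ => Finset.sum_eq_zero fun j _ =>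
      Finset.sum_eq_zero fun k _ => ?_
    by_cases hj : j ∈ T
    · rw [show B b j = 0 from hG b hbS j hj, mul_zero, zero_mul, zero_mul]
    · rw [show t i j k = 0 from not_not.1 fun h => hj (hT i j k h), mul_zero]
  · intro hT hG a b c hne
    by_contra hcS
    apply hne
    rw [actTensor_apply]
    refine Finset.sum_eq_zero fun i _ => Finset.sum_eq_zero fun j _ =>
      Finset.sum_eq_zero fun k _ => ?_
    by_cases hk : k ∈ T
    · rw [show C c k = 0 from hG c hcS k hk, mul_zero, zero_mul]
    · rw [show t i j k = 0 from not_not.1 fun h => hk (hT i j k h), mul_zero]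

/-- `pad_m⟨n,n,n⟩` is supported, in every slot, in the first `n²` coordinates. [bookkeeping] -/
theorem slot_lt_of_padMM_ne_zero {n m : ℕ} (h : n * n ≤ m) : ∀ s : Fin 3, ∀ a b c : Fin m,
    padMM ℂ n m h a b c ≠ 0 → ((slot s (a, b, c) : Fin m) : ℕ) < n * n := by
  have key : ∀ a b c : Fin m, padMM ℂ n m h a b c ≠ 0 →
      (a : ℕ) < n * n ∧ (b : ℕ) < n * n ∧ (c : ℕ) < n * n := by
    intro a b c hne
    unfold padMM padTensor at hne
    obtain ⟨q, _, hq⟩ := Finset.exists_ne_zero_of_sum_ne_zero hne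
    have hq' : padIdx n m h q.1 = a ∧ padIdx n m h q.2.1 = b ∧ padIdx n m h q.2.2 = c := by
      by_contra hnot
      exact hq (by rw [if_neg hnot, zero_mul])
    obtain ⟨h1, h2, h3⟩ := hq'
    exact ⟨h1 ▸ (finProdFinEquiv q.1).isLt, h2 ▸ (finProdFinEquiv q.2.1).isLt,
      h3 ▸ (finProdFinEquiv q.2.2).isLt⟩
  exact forall_fin_three.2 ⟨fun a b c hne => (key a b c hne).1, fun a b c hne => (key a b c hne).2.1,
    fun a b c hne => (key a b c hne).2.2⟩

end Slots

end Summit.MatrixMultiplication.MatrixMultiplication.Theorems.ObstructionCalculus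

end
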